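import Summits.BirchSwinnertonDyer.BirchSwinnertonDyer.Theorems.GenusKolyvaginAtTwoPowDvdShaCardAtTwoPosTExactSwapCoreTransposition
import Summits.BirchSwinnertonDyer.BirchSwinnertonDyer.Theorems.GenusKolyvaginAtTwoPowDvdShaCardAtTwoRTExactSwapHybrid
import Summits.BirchSwinnertonDyer.BirchSwinnertonDyer.Theorems.GenusKolyvaginAtTwoPowDvdShaCardAtTwoPosTExactSwapLawKummerTransposition
import Summits.BirchSwinnertonDyer.BirchSwinnertonDyer.Theorems.GenusKolyvaginAtTwoPowDvdShaCardAtTwoPosTExactSwapLawTransverseTransposition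
import Summits.BirchSwinnertonDyer.BirchSwinnertonDyer.Theorems.KolyvaginRankRigidityAtTwoSwapAuxClassGlobalAtTwo
import Summits.BirchSwinnertonDyer.BirchSwinnertonDyer.Theorems.KolyvaginRankRigidityAtTwoSwapWeilDatumLiftChange
import Summits.BirchSwinnertonDyer.Rank1Residual.JET.TransverseFamilyConjAct
import Summits.BirchSwinnertonDyer.BirchSwinnertonDyer.Theorems.KolyvaginRankRigidityAtTwoTransversePackageAtTwo
import Summits.BirchSwinnertonDyer.BirchSwinnertonDyer.Theorems.KolyvaginRankRigidityAtTwoTransverseClassAtTwo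
import Summits.BirchSwinnertonDyer.BirchSwinnertonDyer.Theorems.ByReductionTypeAtTwoRankOneAtTwoBigImageOddLocalOneDoorBottomLemma43AtTwo
import Summits.BirchSwinnertonDyer.BirchSwinnertonDyer.Theorems.KolyvaginRankRigidityAtTwoSwapOfNamedFacts
import HarnessLib

/-!
# Route `GenusKolyvaginAtTwo`, crux L⁺_T `PowDvdShaCardAtTwoPosT` (stmt-BirchSwinnertonDyer-23379), road (E4)⁺, socket swap⁺ —
# THE EXACT PRIME SWAP AT 2 ON THE HYBRID FRAME AND THE KS `hswap` SOCKET, AT TRANSPOSITION-DEEP PRIMES, SIGN-FREE IN `Δ`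
# (LEAD g18's `exactSwap_core_hybrid_frob` / `exactSwapAtTwo` / `deepSwap_socket` with `Δ < 0` deleted and `FrobEqFrobInfty` ↦ the transposition clause)

Seat `bsd-line-gk2-p5` g32 (WIDTH-5 attach, cell `bsd-f1-sign2`), `--supports stmt-BirchSwinnertonDyer-23379` (helper; closes nothing).
THEOREMS ONLY (no definition, no named fact, no `sorry`).  BSD is NOT proved by any of this; neither is L⁺_T nor any stub (KS⁺ included).

WHAT (LEAD gk2-p1 g20 memo `Cruxes/KolyvaginExactAtTwoPosDiscT/R10-LPLUS-ROAD-E4POS-g20.md` §0.3 «swap⁺», ruling R10′ 02:02Z: the socket the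
KS⁺ assembly (gk2-p2 lineage) consumes).  The three theorems of `…RTExactSwapHybridFrob` (LEAD gk2-p1 g18) ported to the TRANSPOSITION class
«some arithmetic Frobenius above `q` moves a point of `E[2]`» (`TRANSP q` below, spelled inline; level-free; on `Δ < 0` implied by Gross's
`FrobEqFrobInfty W K 2 q` — gk2-p2 g22 `transposition_of_frobEqFrobInfty_of_Δ_neg` — and on either sign supplied beyond every bound by
`regularKolyvaginSupplyAtTwo_proof` / gk2-p4 g23 Part C / `…PosTTranspositionPairChebotarev`):
* (inlined) LEAD g18's hybrid frame `exactSwap_core_hybrid_frob` — P8, P4 (= (V44) margin one), `τ`-stability, P5 (krr2-p2's signed auxiliary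
  class), T2 (`t = 0`, odd Tamagawa) verbatim; P7a⁼/P7b⁼ := the sign-free exact laws `swapPairing_pow_smul_{ne,eq}_zero_at_two_exact_of_transposition`
  — feeds `exactSwap_core_transposition` (`…PosTExactSwapCoreTransposition`) inside the next theorem (a separate frame theorem would have the
  core's type verbatim once the transposition clause is level-free: `dedup.landed`);
* `exactSwapAtTwo_transposition` — the frame instantiated (Poitou–Tate families, Weil data, hybrid structures built inside, as in `exactSwapAtTwo`):
  the swap in pure Kolyvagin-datum currency, modulo Q2 + (NPh_{M+k}) only, NO sign of `Δ`, NO non-square side condition;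
* **`deepSwap_socket_transposition`** — gk2-p2's `hswap` binder VERBATIM for the margin-`k` class
  `G q := L + k ≤ idx q ∧ TRANSP q` (`k ≥ 1`, `L ≥ 2M₀ + 12`): = `deepSwap_socket` with `FrobEqFrobInfty W K (2^(L+k)) q` ↦ `TRANSP q` at all
  four occurrences (hypothesis class, level class, output prime) and `hΔ`, `hns` gone.
Displayed inputs that remain: Q2 `KolyvaginRelationAtTwo` (by name), (NPh) at level `2^(L+k)` in the robust `2N`-form.  For the KS⁺ assembler: the
companion `RelaxedCount.exists_kolyvaginMinima_pred` still carries `hΔ`/`hns` (its `hG` is fed by the `Δ < 0` Čebotarev) and wants the same port.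

References: [McCallumLMS1991] §5 Prop. 5.2 (proof), Lemma 5.3, Lemma 4.3; [Kolyvagin1991MathAnn] §2 Thm. 2.2; [Howard2004HeegnerKolyvagin]
Lemma 2.7.3; [GrossLMS1991] §3 (3.1)–(3.3), Prop. 6.2.
-/

set_option autoImplicit false
set_option linter.dupNamespace false

noncomputable section

open scoped Classical Pointwise
open Function NumberField IsDedekindDomain WeierstrassCurve Field
open Literature.NumberTheory.EllipticCurves Literature.NumberTheory.GaloisRepresentations
open Literature.NumberTheory.EllipticCurves.Jetchev2008 Literature.NumberTheory.EllipticCurves.ModularForms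
open Literature.NumberTheory.GaloisCohomology
open Literature.NumberTheory.GaloisRepresentations.DiscreteGaloisModule (localTatePairingZMod
  tateDual transverseSubgroup SelmerStructure)
open Literature.NumberTheory.Automorphic
open Summit.BirchSwinnertonDyer.Rank1Residual
open Summit.BirchSwinnertonDyer.Rank1Residual.JET.SelmerVocabulary
open Summit.BirchSwinnertonDyer.Rank1Residual.JET.GlobalDuality
open Summit.BirchSwinnertonDyer.BirchSwinnertonDyer.Theses.GenusKolyvaginAtTwo (KolyvaginRelationAtTwo)
open Summit.BirchSwinnertonDyer.BirchSwinnertonDyer.Theorems.KolyvaginLowerBoundAtTwo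

namespace Summit.BirchSwinnertonDyer.BirchSwinnertonDyer.Theorems.GenusExact.PlusDescent


/-! ## The frame instantiated: the swap in pure Kolyvagin-datum currency, and gk2-p2's `hswap` socket -/

section Instantiated

variable {K : Type} [Field K] [NumberField K] (W : WeierstrassCurve ℚ) [W.IsElliptic] [W.IsGloballyMinimal] [NeZero (W.conductorNorm ℤ)]

/-- **THE EXACT PRIME SWAP AT `2` AT TRANSPOSITION-DEEP PRIMES, frame instantiated, UNCONDITIONAL up to Q2 and (NPh), any sign of `Δ`**
(the `hswap` socket with margin `k`, in pure Kolyvagin-datum currency; = LEAD g18's `exactSwapAtTwo` ∘ `exactSwap_core_hybrid_frob` with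
`Δ < 0`, `hns` deleted and `FrobEqFrobInfty` ↦ the transposition clause; proofs adapted verbatim, the hybrid frame inlined).  [cite: McCallumLMS1991, §5 Prop. 5.2 (proof), Lemma 5.3]
[cite: Kolyvagin1991MathAnn, §2 Thm. 2.2] [cite: GrossLMS1991, §3 (3.1)–(3.3)] -/
theorem exactSwapAtTwo_transposition (hCM : ¬ W.HasCM) (hTam : Odd W.tamagawaProduct)
    (hsur : ∀ m : ℕ, W.HasSurjectiveModNGaloisRep (2 ^ m : ℕ)) (hK : IsImaginaryQuadratic K)
    (hodd : Odd (NumberField.discr K)) (hne3 : NumberField.discr K ≠ -3)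
    (hHN : SatisfiesHeegnerHypothesis (W.conductorNorm ℤ) K) (τ : K ≃ₐ[ℚ] K) (hτ1 : τ ≠ 1)
    (Dt : ModularParametrizationData W (W.conductorNorm ℤ)) (β : ℤ) (ι : K →+* ℂ)
    (hQ2 : KolyvaginRelationAtTwo)
    {M k g n a : ℕ} (X : Finset ℕ) (dat : KolyvaginHeegnerData Dt β ι n)
    (hM : 12 ≤ M) (hk : 1 ≤ k) (hn : Squarefree n)
    (hnK : ∀ p ∈ n.primeFactors, Zhang2014.IsKolyvaginPrime (W.conductorNorm ℤ) W K 2 p ∧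
      M + 1 ≤ Zhang2014.kolyvaginIndex W 2 p)
    (ha : a ∈ n.primeFactors)
    (haR : ∃ (v₁ : HeightOneSpectrum (𝓞 ℚ)) (𝔓 : Ideal (absIntegers (𝓞 ℚ) ℚ)) (h : absoluteGaloisGroup ℚ),
      (a : 𝓞 ℚ) ∈ v₁.asIdeal ∧ 𝔓 ∈ v₁.primesAbove ∧ IsArithFrobAt (𝓞 ℚ) h 𝔓 ∧ ∃ u : geomTorsion W 2, h • u ≠ u)
    (hg : 1 ≤ g) (hord : addOrderOf (dat.kolyvaginClass Nat.prime_two M) = 2 ^ g)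
    (hroom : M + 6 ≤ M / 2 + g)
    (hNPh : ∀ z : galH1Torsion (W.baseChange K) ((2 ^ (M + k) : ℕ) : ℤ),
      (∀ ρ ∈ torsionFixing (W.baseChange K) ((2 ^ (M + k) : ℕ) : ℤ),
        h1Eval (W.baseChange K) ((2 ^ (M + k) : ℕ) : ℤ) z ρ = 0) →
      (∀ w : HeightOneSpectrum (𝓞 K), ((2 * W.conductorNorm ℤ : ℕ) : 𝓞 K) ∈ w.asIdeal →
        z ∈ selmerLocalKer (W.baseChange K) (w.adicCompletion K) ((2 ^ (M + k) : ℕ) : ℤ)) → z = 0) :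
    ∃ ℓ : ℕ, ℓ ∉ X ∧ ℓ ∉ n.primeFactors ∧ Zhang2014.IsKolyvaginPrime (W.conductorNorm ℤ) W K 2 ℓ ∧
      M + k ≤ Zhang2014.kolyvaginIndex W 2 ℓ ∧
      (∃ (v₁ : HeightOneSpectrum (𝓞 ℚ)) (𝔓 : Ideal (absIntegers (𝓞 ℚ) ℚ)) (h : absoluteGaloisGroup ℚ),
        (ℓ : 𝓞 ℚ) ∈ v₁.asIdeal ∧ 𝔓 ∈ v₁.primesAbove ∧ IsArithFrobAt (𝓞 ℚ) h 𝔓 ∧ ∃ u : geomTorsion W 2, h • u ≠ u) ∧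
      (∀ v : HeightOneSpectrum (𝓞 K), ((ℓ : ℕ) : 𝓞 K) ∈ v.asIdeal →
        ((2 ^ (g - 1) : ℕ) : ℤ) • dat.kolyvaginClass Nat.prime_two M ∉
          (W.baseChange K).torsionLocalKer (v.adicCompletion K) ((2 ^ M : ℕ) : ℤ)) ∧
      ∃ dat' : KolyvaginHeegnerData Dt β ι (n / a * ℓ),
        ((2 ^ (g - 1) : ℕ) : ℤ) • dat'.kolyvaginClass Nat.prime_two M ≠ 0 := by
  classical
  haveI : Fact (Nat.Prime 2) := ⟨Nat.prime_two⟩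
  haveI : ∀ j : ℕ, NumberField (ringClassField K ι j) := JET.numberField_ringClassField K hK ι
  haveI : (W.baseChange K).IsElliptic := by rw [baseChange]; infer_instance
  haveI hNZ : ∀ M : ℕ, NeZero (2 ^ M) := fun M ↦ ⟨pow_ne_zero M two_ne_zero⟩
  haveI : ∀ M : ℕ, Finite (geomTorsion (W.baseChange K) ((2 ^ M : ℕ) : ℤ)) := fun M ↦
    finite_geomTorsion_of_neZero (W.baseChange K) (2 ^ M)
  -- the frame, per level: Poitou–Tate families, Weil data, hybrid structures
  have hinv : ∀ M : ℕ, ∃ inv : LocalInvariants K (2 ^ M), inv.IsPerfect ∧ inv.SumLocalTermEqZero ∧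
      inv.UnramifiedOrthogonal ∧ inv.SelmerComplement ∧ ∀ σ : K ≃ₐ[ℚ] K, inv.IsConjCompatible σ :=
    fun M ↦ InputsPoitouTateSelmer.poitouTate_selmerStructure_duality_conj_holds K (2 ^ M)
  choose inv hperf hvan hUO hSC hconj using hinv
  have hweil := fun M : ℕ ↦ exists_weilDatum_liftAut_two_pow (K := K) W τ M
  choose e hμ hadd₁ hadd₂ hgal halt hnondeg hτe using hweil
  have hhyb := fun M : ℕ ↦ exists_hybridTransverseFamily (K := K) W ι M
  choose 𝒯 hTko hTku using hhyb
  have hinvc : ∀ M : ℕ, (inv M).IsConjCompatible τ := fun M ↦ hconj M τ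
  -- (the hybrid frame of LEAD g18's `exactSwap_core_hybrid_frob`, inlined: P8, P4, τ-stability, P5, P7a⁼/P7b⁼ (transposition), T2)
  have hne4 : NumberField.discr K ≠ -4 := fun h ↦ by
    rw [h] at hodd; have := Int.odd_iff.mp hodd; omega
  have hD : NumberField.discr K < -4 := IsImaginaryQuadratic.discr_lt_neg_four_of_odd hK hodd hne3
  have hττ : τ * τ = 1 := mul_self_eq_one_of_isImaginaryQuadratic hK τ
  have hinj : ∀ (M : ℕ) (v : HeightOneSpectrum (𝓞 K)), Injective (inv M (Sum.inr v)) :=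
    fun M v ↦ ((hperf M) v).1.injective
  -- P8: self-duality of the hybrid structure at every finite place
  have h𝒯sd : ∀ (M c : ℕ), ∀ v ∈ placesDividing K c,
      (inv M).dualTransported (𝒯 M) (weilDualIntertwining (W.baseChange K) (2 ^ M) (e M) (hμ M) (hadd₁ M)
        (hadd₂ M) (hgal M)) (Sum.inr v) = 𝒯 M (Sum.inr v) := fun M c ↦
    dualTransported_eq_of_hybrid W M (e M) (hμ M) (hadd₁ M) (hadd₂ M) (hgal M) (halt M) (hnondeg M) (inv M)
      (𝒯 M) hK hD ι (hinj M) (fun v ↦ by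
        by_cases h : ∃ q : ℕ, Zhang2014.IsKolyvaginPrime (W.conductorNorm ℤ) W K 2 q ∧
            M + 1 ≤ Zhang2014.kolyvaginIndex W 2 q ∧ (q : 𝓞 K) ∈ v.asIdeal
        · obtain ⟨q, hq, hMq, hqv⟩ := h
          exact Or.inl ⟨q, hq, hMq, hqv, hTko M v q hq hMq hqv⟩
        · exact Or.inr (hTku M v h)) c
  -- P4: transversality at the primes of the conductor — (V44) at margin one, unconditional at 2
  have hP4 : ∀ (M c : ℕ) (dat : KolyvaginHeegnerData Dt β ι c),
      KolyvaginDescent.KolSupp (Zhang2014.IsKolyvaginPrime (W.conductorNorm ℤ) W K 2) c → 1 ≤ M →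
      (∀ q ∈ c.primeFactors, M + 1 ≤ Zhang2014.kolyvaginIndex W 2 q) →
      ∀ w ∈ placesDividing K c,
        galoisCohomology.localization ((W.baseChange K).torsionGaloisModule ((2 ^ M : ℕ) : ℤ)) (Sum.inr w) 1
          (dat.kolyvaginClass Nat.prime_two M) ∈ 𝒯 M (Sum.inr w) := by
    intro M c dat hc _ hcM w hw
    obtain ⟨𝒯g, h𝒯g, -⟩ := JET.Walk.exists_globalTransverseFamily W ι ((2 ^ M : ℕ) : ℤ)
    have hmem := JET.localization_kolyvaginClass_mem_globalTransverse_two W hK hD Dt β ι M h𝒯g dat hc hcM w hw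
    obtain ⟨q, hqc, hqw⟩ := (natCast_mem_iff_exists_primeFactor_mem hc.1.ne_zero w).mp
      ((mem_placesDividing_iff_natCast_mem hc.1.ne_zero w).mp hw)
    rw [hTko M w q (hc.2 q hqc) (hcM q hqc) hqw, ← JET.Walk.globalTransverse_eq_of_natCast_mem h𝒯g w
      (Nat.prime_of_mem_primeFactors hqc) hqw]
    exact hmem
  -- τ-stability of the hybrid structure at the places of a Kolyvagin conductor
  have h𝒯σ : ∀ (M m : ℕ), KolyvaginDescent.KolSupp (Zhang2014.IsKolyvaginPrime (W.conductorNorm ℤ) W K 2) m →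
      (∀ q ∈ m.primeFactors, M + 1 ≤ Zhang2014.kolyvaginIndex W 2 q) →
      ∀ (v w : HeightOneSpectrum (𝓞 K)) (h : τ • v = w), v ∈ placesDividing K m →
      ∀ x : galoisCohomology (((W.baseChange K).torsionGaloisModule ((2 ^ M : ℕ) : ℤ)).toLocal
        (Sum.inr v : Place K)) 1, x ∈ 𝒯 M (Sum.inr v) → conjActPlace W τ ((2 ^ M : ℕ) : ℤ) h x ∈ 𝒯 M (Sum.inr w) := by
    intro M m hm hmidx v w h hv x hx
    obtain ⟨𝒯g, h𝒯g, -⟩ := JET.Walk.exists_globalTransverseFamily W ι ((2 ^ M : ℕ) : ℤ)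
    obtain ⟨q, hqm, hqv⟩ := (natCast_mem_iff_exists_primeFactor_mem hm.1.ne_zero v).mp
      ((mem_placesDividing_iff_natCast_mem hm.1.ne_zero v).mp hv)
    have hq := hm.2 q hqm
    have hvv : τ • v = v := smul_place_eq_self_of_natCast_mem τ hq.1.ne_zero hq.2.2.2.2.1 v hqv
    have hvw : v = w := hvv.symm.trans h
    subst hvw
    have heq : 𝒯 M (Sum.inr v) = 𝒯g (Sum.inr v) := by
      rw [hTko M v q hq (hmidx q hqm) hqv, JET.Walk.globalTransverse_eq_of_natCast_mem h𝒯g v hq.1 hqv]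
    rw [heq] at hx ⊢
    exact JET.Walk.globalTransverse_conjActPlace_mem h𝒯g τ hm.1
      (JET.forall_conjActPlace_mem_of_eq_iInf_transverseSubgroup W hK ι τ _ m) v v h hv x hx
  -- P5: krr2-p2's SIGNED auxiliary class with size on the hybrid structure (M ≥ 9)
  have hP5 : ∀ (M m a : ℕ) (v₀ : HeightOneSpectrum (𝓞 K)) (s : ℤ), (s = 1 ∨ s = -1) → 9 ≤ M →
      KolyvaginDescent.KolSupp (Zhang2014.IsKolyvaginPrime (W.conductorNorm ℤ) W K 2) m →
      (∀ q ∈ m.primeFactors, M + 1 ≤ Zhang2014.kolyvaginIndex W 2 q) →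
      Zhang2014.IsKolyvaginPrime (W.conductorNorm ℤ) W K 2 a → M + 1 ≤ Zhang2014.kolyvaginIndex W 2 a →
      ¬ a ∣ m → ((a : ℕ) : 𝓞 K) ∈ v₀.asIdeal →
      ∃ w : galoisCohomology ((W.baseChange K).torsionGaloisModule ((2 ^ M : ℕ) : ℤ)) 1,
        w ∈ signPart W K τ ((2 ^ M : ℕ) : ℤ) s
          (((selmerF W ((2 ^ M : ℕ) : ℤ) (𝒯 M) (placesDividing K m)).relaxedAt {v₀}).selmerGroup) ∧
        ((2 ^ (M / 2 - 5) : ℕ) : ℤ) • w ≠ 0 := by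
    intro M m a v₀ s hs hM9 hm hmidx ha hMa ham hv₀
    have hfix : τ • v₀ = v₀ := smul_place_eq_self_of_natCast_mem τ ha.1.ne_zero ha.2.2.2.2.1 v₀ hv₀
    have hτe' : ∀ S T, liftAutPlace τ hfix (e M S T) =
        e M ((isLiftOfAut_liftAutPlace τ hfix).torsionMap W ((2 ^ M : ℕ) : ℤ) S)
          ((isLiftOfAut_liftAutPlace τ hfix).torsionMap W ((2 ^ M : ℕ) : ℤ) T) := fun S T ↦
      weil_equivariant_of_isLiftOfAut W ((2 ^ M : ℕ) : ℤ) (isLiftOfAut_liftAutPlace τ hfix) (isLiftOfAut_liftAut τ)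
        (e M) (hgal M) (hτe M) S T
    exact exists_auxClass_large_at_two W τ M (e M) (hμ M) (hadd₁ M) (hadd₂ M) (hgal M) (halt M) (hnondeg M) (inv M)
      (𝒯 M) hK hτ1 hττ (hperf M) (hvan M) (hSC M) (hinvc M) hM9 hm.1.ne_zero (h𝒯sd M m)
      (h𝒯σ M m hm hmidx) ha hMa ham v₀ hv₀ hfix hτe' hs
  -- P7a⁼ / P7b⁼: the sign-free exact local laws at transposition-deep places (cyclic eigenlines of the REGULAR Frobenius)
  have hP7a := swapPairing_pow_smul_ne_zero_at_two_exact_of_transposition (W := W) (τ := τ) (e := e) (hμ := hμ) (hadd₁ := hadd₁)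
    (hadd₂ := hadd₂) (hgal := hgal) (halt := halt) (hnondeg := hnondeg) (inv := inv) hK hτ1 hττ hτe hinj hinvc
  have hP7b := swapPairing_pow_smul_eq_zero_at_two_exact_of_transposition (W := W) (τ := τ) (ι := ι) (e := e) (hμ := hμ) (hadd₁ := hadd₁)
    (hadd₂ := hadd₂) (hgal := hgal) (halt := halt) (hnondeg := hnondeg) (inv := inv) (𝒯 := 𝒯) hK hD hτ1 hττ hτe hperf hinvc hTko
  -- T2 with t = 0: Gross 6.2(1) / McCallum 4.3 at 2 on the odd-Tamagawa habitat
  have hT2 := pow_zero_zsmul_kolyvaginClass_two_mem_selmerLocalKer_of_odd_tamagawaProduct W hsur hTam hK hne3 hne4 hHN Dt β ι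
  exact exactSwap_core_transposition (W := W) (τ := τ) (Dt := Dt) (β := β) (ι := ι)
    (e := e) (hμ := hμ) (hadd₁ := hadd₁) (hadd₂ := hadd₂) (hgal := hgal) (halt := halt) (hnondeg := hnondeg) (inv := inv) (𝒯 := 𝒯)
    (hCM := hCM) (hsur := hsur) (hK := hK) (hodd := hodd) (hne3 := hne3) (hHN := hHN) (hτ1 := hτ1)
    (hperf := hperf) (hvan := hvan) (h𝒯sd := h𝒯sd) (hP4 := hP4) (hP5 := hP5) (hP7a := hP7a) (hP7b := hP7b)
    (hQ2 := hQ2) (hT2 := hT2) X dat hM hk hn hnK ha haR hg hord hroom hNPh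

/-- **The KS⁺ `hswap` socket at TRANSPOSITION-deep primes, modulo Q2 + (NPh), any sign of `Δ`** (gk2-p2's `hswap` binder of
`kolyvaginSuppliesAtTwo_of_deepSwap(_pred)` for the margin-`k` class `G q := L + k ≤ index q ∧ TRANSP q`, `TRANSP q` := «some arithmetic
Frobenius above `q` moves a point of `E[2]`», `k ≥ 1`, level `L ≥ 2M₀ + 12`): for `r ≥ 1`, `m < M₀`, every depth-`r` level `n` in the class with
`addOrderOf c_L(n) = 2^(L−m)` and every `ℓ₀ ∣ n` admit a fresh `ℓ′` in the class outside any finite `X`, at whose place `2^(L−m−1) c_L(n)` is locally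
non-zero, and a datum at `ℓ′·(n/ℓ₀)` with `2^(L−m−1) • c_L ≠ 0` — `exactSwapAtTwo_transposition` with `M := L`, `g := L − m`, `a := ℓ₀`.
(= LEAD g18's `deepSwap_socket` with `FrobEqFrobInfty W K (2^(L+k)) q` ↦ `TRANSP q` throughout and `Δ < 0`, `hns` deleted; proof adapted verbatim.)
[cite: McCallumLMS1991, §5 Prop. 5.2 (proof)] [cite: Kolyvagin1991MathAnn, §2 Thm. 2.2] [cite: GrossLMS1991, §3 (3.1)–(3.3)] -/
theorem deepSwap_socket_transposition (hCM : ¬ W.HasCM) (hTam : Odd W.tamagawaProduct)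
    (hsur : ∀ m : ℕ, W.HasSurjectiveModNGaloisRep (2 ^ m : ℕ)) (hK : IsImaginaryQuadratic K)
    (hodd : Odd (NumberField.discr K)) (hne3 : NumberField.discr K ≠ -3)
    (hHN : SatisfiesHeegnerHypothesis (W.conductorNorm ℤ) K) (τ : K ≃ₐ[ℚ] K) (hτ1 : τ ≠ 1)
    (Dt : ModularParametrizationData W (W.conductorNorm ℤ)) (β : ℤ) (ι : K →+* ℂ)
    (hQ2 : KolyvaginRelationAtTwo)
    {M₀ L k : ℕ} (hL : 2 * M₀ + 12 ≤ L) (hk : 1 ≤ k)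
    (hNPh : ∀ z : galH1Torsion (W.baseChange K) ((2 ^ (L + k) : ℕ) : ℤ),
      (∀ ρ ∈ torsionFixing (W.baseChange K) ((2 ^ (L + k) : ℕ) : ℤ),
        h1Eval (W.baseChange K) ((2 ^ (L + k) : ℕ) : ℤ) z ρ = 0) →
      (∀ w : HeightOneSpectrum (𝓞 K), ((2 * W.conductorNorm ℤ : ℕ) : 𝓞 K) ∈ w.asIdeal →
        z ∈ selmerLocalKer (W.baseChange K) (w.adicCompletion K) ((2 ^ (L + k) : ℕ) : ℤ)) → z = 0) :
    ∀ (r m : ℕ), 1 ≤ r → m < M₀ →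
      (∀ (n : ℕ) (e : KolyvaginHeegnerData Dt β ι n), Squarefree n → n.primeFactors.card = r →
        (∀ q ∈ n.primeFactors, (Zhang2014.IsKolyvaginPrime (W.conductorNorm ℤ) W K 2 q ∧ L ≤ Zhang2014.kolyvaginIndex W 2 q) ∧
          (L + k ≤ Zhang2014.kolyvaginIndex W 2 q ∧
          (∃ (v₁ : HeightOneSpectrum (𝓞 ℚ)) (𝔓 : Ideal (absIntegers (𝓞 ℚ) ℚ)) (h : absoluteGaloisGroup ℚ),
            (q : 𝓞 ℚ) ∈ v₁.asIdeal ∧ 𝔓 ∈ v₁.primesAbove ∧ IsArithFrobAt (𝓞 ℚ) h 𝔓 ∧ ∃ u : geomTorsion W 2, h • u ≠ u))) →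
        ((2 ^ (L - m) : ℕ) : ℤ) • e.kolyvaginClass Nat.prime_two L = 0) →
      ∀ (n : ℕ) (d : KolyvaginHeegnerData Dt β ι n), Squarefree n → n.primeFactors.card = r →
      (∀ q ∈ n.primeFactors, (Zhang2014.IsKolyvaginPrime (W.conductorNorm ℤ) W K 2 q ∧ L ≤ Zhang2014.kolyvaginIndex W 2 q) ∧
        (L + k ≤ Zhang2014.kolyvaginIndex W 2 q ∧
          (∃ (v₁ : HeightOneSpectrum (𝓞 ℚ)) (𝔓 : Ideal (absIntegers (𝓞 ℚ) ℚ)) (h : absoluteGaloisGroup ℚ),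
            (q : 𝓞 ℚ) ∈ v₁.asIdeal ∧ 𝔓 ∈ v₁.primesAbove ∧ IsArithFrobAt (𝓞 ℚ) h 𝔓 ∧ ∃ u : geomTorsion W 2, h • u ≠ u))) →
      addOrderOf (d.kolyvaginClass Nat.prime_two L) = 2 ^ (L - m) →
      ∀ ℓ₀ ∈ n.primeFactors, ∀ X : Finset ℕ, ∃ ℓ' : ℕ, ℓ' ∉ X ∧ ℓ' ∉ n.primeFactors ∧
        ((Zhang2014.IsKolyvaginPrime (W.conductorNorm ℤ) W K 2 ℓ' ∧ L ≤ Zhang2014.kolyvaginIndex W 2 ℓ') ∧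
          (L + k ≤ Zhang2014.kolyvaginIndex W 2 ℓ' ∧
          (∃ (v₁ : HeightOneSpectrum (𝓞 ℚ)) (𝔓 : Ideal (absIntegers (𝓞 ℚ) ℚ)) (h : absoluteGaloisGroup ℚ),
            (ℓ' : 𝓞 ℚ) ∈ v₁.asIdeal ∧ 𝔓 ∈ v₁.primesAbove ∧ IsArithFrobAt (𝓞 ℚ) h 𝔓 ∧ ∃ u : geomTorsion W 2, h • u ≠ u))) ∧
        (∃ v : HeightOneSpectrum (𝓞 K), ((ℓ' : ℕ) : 𝓞 K) ∈ v.asIdeal ∧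
          ((2 ^ (L - m - 1) : ℕ) : ℤ) • d.kolyvaginClass Nat.prime_two L ∉
            (W.baseChange K).torsionLocalKer (v.adicCompletion K) ((2 ^ L : ℕ) : ℤ)) ∧
        ∃ d' : KolyvaginHeegnerData Dt β ι (ℓ' * (n / ℓ₀)),
          ((2 ^ (L - m - 1) : ℕ) : ℤ) • d'.kolyvaginClass Nat.prime_two L ≠ 0 := by
  intro r m _ hm _ n d hn _ hadm hord ℓ₀ hℓ₀ X
  have hnK : ∀ p ∈ n.primeFactors, Zhang2014.IsKolyvaginPrime (W.conductorNorm ℤ) W K 2 p ∧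
      L + 1 ≤ Zhang2014.kolyvaginIndex W 2 p := fun p hp ↦ ⟨(hadm p hp).1.1, le_trans (by omega) (hadm p hp).2.1⟩
  obtain ⟨ℓ, hℓX, hℓn, hKol, hidx, hfrob, hdet, d', hd'⟩ := exactSwapAtTwo_transposition W hCM hTam hsur hK hodd hne3 hHN τ hτ1
    Dt β ι hQ2 (M := L) (k := k) (g := L - m) X d (by omega) hk hn hnK hℓ₀ (hadm ℓ₀ hℓ₀).2.2 (by omega) hord
    (by omega) hNPh
  have hℓp : ℓ.Prime := hKol.1
  obtain ⟨v, hv⟩ : ∃ v : HeightOneSpectrum (𝓞 K), ((ℓ : ℕ) : 𝓞 K) ∈ v.asIdeal :=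
    ⟨⟨Ideal.span {((ℓ : ℕ) : 𝓞 K)}, hKol.2.2.2.2.1, by
        rw [Ne, Ideal.span_singleton_eq_bot]; exact_mod_cast hℓp.ne_zero⟩,
      Ideal.mem_span_singleton_self _⟩
  have hcast : n / ℓ₀ * ℓ = ℓ * (n / ℓ₀) := Nat.mul_comm _ _
  refine ⟨ℓ, hℓX, hℓn, ⟨⟨hKol, le_trans (Nat.le_add_right L k) hidx⟩, hidx, hfrob⟩,
    ⟨v, hv, hdet v hv⟩, hcast ▸ d', ?_⟩
  rw [kolyvaginClass_cast_swap hcast d' L]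
  exact hd'

end Instantiated

end Summit.BirchSwinnertonDyer.BirchSwinnertonDyer.Theorems.GenusExact.PlusDescent

end
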